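import Summits.HodgeConjecture.CorCM.MultiFieldWeilTwinsKindRealised
import Summits.HodgeConjecture.CorCM.MultiFieldWeilTwinsSextics
import Summits.HodgeConjecture.CorCM.MultiFieldWeilSimpleSlots
import HarnessLib

/-!
# MULTI-FIELD WEIL ENGINE — SEXTIC TWIN PAIRS INSIDE THE MENU: `E` + pairs `B_m ≁ B_{tw m}` of SIMPLE CM threefolds over ONE sextic CM field each + further SIMPLE CM
# threefolds + SIMPLE CM fourfolds (octic fields, `𝔄₄`/`𝔖₄` quartic part) + `(2,3)`/`(3,2)` CM fivefolds, all through `k` — the Hodge conjecture for every product of copies,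
# given only Markman's fourfold and hyperbolic-sixfold theorems

Cell `pub-hodgecm2` (COR-CM), seat b30 gen 38 (2026-08-25); own lane MULTI-FIELD WEIL ENGINE (stem `MultiFieldWeil*`), the geometric consumer of
`CorCM/MultiFieldWeilTwinsKindRealised.lean` (T2c: frames headline with several twin pairs and the slot menu on the single slots), after the pattern of gen 37's
`CorCM/MultiFieldWeilTwinsSextics.lean` (T3b: all slots sextic) with the single slots widened to the menu of `CorCM/MultiFieldWeilSimpleSlots.lean` (Y6 §3).  Theorems only; no
definition, no named fact, no `sorry`.  HONEST FRAMING: conditional ONLY on the two displayed Markman binders; `HC_CM` is NOT proved and not asserted.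

THE SETTING.  Slots `is : Fin r → I` over CM fields `Kf i ⊇ iK i (k)`, `k = Kf i₀` imaginary quadratic, sizes `n_m = nI (is m) ∈ {3, 4, 5}` attached to the INDEX; an involution
`tw` of `Fin r` whose `2`-element fibres — the TWIN PAIRS — share their index (`is (tw m) = is m`) and are SEXTIC (`nI = 3`); `E = A 0 ⊨ (k; {τ})`, `B_m = A (m+1) ⊨ (K_m; Φ (m+1))`.
HYPOTHESES: `B_m` SIMPLE for `n_m ∈ {3, 4}`, of `k`-signature `(2,3)` ∕ `(3,2)` for `n_m = 5`; twins NON-ISOGENOUS (`B_m ≁ B_{tw m}`); every octic field with two `τ`-embeddings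
generating degree `24` with `τ(k)`; for `m₀ ≠ m` in DIFFERENT units, both sextic or both decic: `Hom(K_m, K_{m₀}) = ∅`; for `K_{m₀}` octic and `K_m` octic or sextic: a
`τ`-embedding of `K_m` with a value outside `L(K_{m₀})`.  THEN (**`hodgeConjectureFor_biproduct_comp_of_twinsMenu`**) the Hodge conjecture holds for EVERY product of copies
`⨁_j A(κ j)`, GIVEN ONLY Markman's two theorems.  In words: over one imaginary quadratic `k`, simple CM threefolds with AT MOST TWO isogeny classes per sextic field and pairwise
non-isomorphic fields otherwise, simple CM fourfolds over pairwise «outside» `𝔄₄`/`𝔖₄`-octic fields, Weil-type CM fivefolds over pairwise non-isomorphic decic fields.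
PROOF = T3b's: types normalised per slot (`exists_realisations_card_eq_of_or`, threefolds to ONE member over `τ`, fourfolds to `1` or `2`, fivefolds to `2`); ONE FRAME PER INDEX
(dihedral at the doubled sextic indices — `DihedralSexticPair.exists_frame_of_card_fibre_eq_one`, transported from `ℤ/3` to `Fin (nI i)` —, a sign frame elsewhere), so the realised
tuples are DIAGONAL on every twin pair; `2`-transitivity on the twins from the six affine maps; stabiliser-transitivity across units by the nine cases of Z3 (W1, Y2, Z2); octic
slots `2`-transitive from degree `24` (Z4) and homogeneous for `(2,2)` (Z1); then T2c's frames headline with the Markman dispatcher.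
NOT covered, honestly: a THIRD isogeny class over a sextic field; twins over octic or decic fields; sister fields; octic fields with imprimitive quartic part.

[cite: Markman2025SurveySecant, Thm. 1.2] [cite: Markman2025SecantWeil, Thm 1.5.1] [cite: Shimura1998, §6.1 Corollary of Theorem 2, §8.2 Prop. 26, §8.4, §18.2 Lemma (i)]
[cite: Deligne1982HodgeCycles, §5 (b)] [cite: Lang2002, VI §1 Thm. 1.14 and V §2 Thm. 2.8] [cite: MoonenZarhin1995Duke, Thm. 2.4] [cite: Pohlmann1968, Thm 1]
[cite: DixonMortimer1996, §1.6, Thm. 1.6A; §2.1; §3.3, Thm. 3.3A] [cite: Dodson1984, §1.1 Imprimitivity Theorem and §5.1.2 Theorem] [cite: MumfordAV1970, §19]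

## References
* [Markman2025SurveySecant] E. Markman, arXiv:2509.23403, Thm. 1.2.  [Markman2025SecantWeil] E. Markman, Cycles on abelian 2n-folds of Weil type from secant sheaves on abelian
  n-folds, Thm 1.5.1.  [Shimura1998] G. Shimura, *Abelian varieties with complex multiplication and modular functions*, §6.1, §8.2, §8.4, §18.2.  [Deligne1982HodgeCycles]
  P. Deligne, LNM 900, §5 (b).  [Lang2002] S. Lang, *Algebra*, GTM 211, V §2, VI §1.  [MoonenZarhin1995Duke] B. Moonen, Yu. Zarhin, Duke Math. J. 77 (1995), Thm. 2.4.
  [Pohlmann1968] H. Pohlmann, Ann. of Math. 88 (1968), Thm 1.  [DixonMortimer1996] J. D. Dixon, B. Mortimer, *Permutation Groups*, GTM 163.  [Dodson1984] B. Dodson, Trans. AMS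
  283 (1984).  [MumfordAV1970] D. Mumford, *Abelian Varieties*, §19.
-/

noncomputable section

open CategoryTheory CategoryTheory.Limits NumberField IntermediateField

namespace Summit.HodgeConjecture.CorCM.MultiFieldWeil

open Finset
open Literature.AlgebraicGeometry Literature.AlgebraicGeometry.Motives Literature.AlgebraicGeometry.HodgeTheory
open Literature.AlgebraicGeometry.ComplexMultiplication (IsCMTypeRealisation)
open Literature.AlgebraicTopology.SingularHomology
open Literature.NumberTheory.ComplexMultiplication
open Summit.HodgeConjecture.CorCM.Census.MultiFieldWeil

open scoped Classical

section TwinsMenu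

variable {I : Type} {r : ℕ} {Kf : I → Type} [∀ i, Field (Kf i)] [∀ i, NumberField (Kf i)] [∀ i, IsCMField (Kf i)]
  {i₀ : I} {is : Fin r → I} {τ : Kf i₀ →+* ℂ}
  {A : Fin (r + 1) → AbelianVariety ℂ} {Φ : ∀ j : Fin (r + 1), CMType (Kf (mfSlots i₀ is j))}
  {ι : ∀ j, 𝓞 (Kf (mfSlots i₀ is j)) →+* End (A j)}
  {θ : ∀ j, Kf (mfSlots i₀ is j) →+* Module.End ℂ (complexBetti (A j).X 1)}

/-- **SEXTIC TWIN PAIRS INSIDE THE MENU — GIVEN ONLY MARKMAN'S FOURFOLD AND HYPERBOLIC-SIXFOLD THEOREMS.**  See the module docstring.  `HC_CM` is NOT asserted.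
[cite: Markman2025SurveySecant, Thm. 1.2] [cite: Markman2025SecantWeil, Thm 1.5.1] [cite: Shimura1998, §6.1 Corollary of Theorem 2, §8.2 Prop. 26, §18.2]
[cite: Deligne1982HodgeCycles, §5 (b)] [cite: DixonMortimer1996, §1.6, Thm. 1.6A; §2.1; §3.3, Thm. 3.3A] [cite: Dodson1984, §1.1 Imprimitivity Theorem and §5.1.2 Theorem] -/
theorem hodgeConjectureFor_biproduct_comp_of_twinsMenu (hW4 : Markman2025_weilClasses_algebraic_abelianFourfold)
    (hM6 : Markman2025_weilClasses_algebraic_hyperbolicSixfold) {N : ℕ} (κ : Fin N → Fin (r + 1)) (h2 : Module.finrank ℚ (Kf i₀) = 2) (nI : I → ℕ)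
    (hnI : ∀ m : Fin r, nI (is m) = 3 ∨ nI (is m) = 4 ∨ nI (is m) = 5) (hdeg : ∀ m : Fin r, Module.finrank ℚ (Kf (is m)) = 2 * nI (is m))
    (iK : ∀ i : I, Kf i₀ →+* Kf i) (hA : ∀ j, IsCMTypeRealisation (Φ j) (A j) (ι j) (θ j)) (hΨ : ∀ σ : Kf i₀ →+* ℂ, σ ∈ (Φ 0).1 ↔ σ = τ)
    (tw : Fin r → Fin r) (htw : ∀ m, tw (tw m) = m) (hι : ∀ m, is (tw m) = is m) (htw3 : ∀ m, tw m ≠ m → nI (is m) = 3)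
    (hS : ∀ m : Fin r, nI (is m) = 3 ∨ nI (is m) = 4 → (A m.succ).IsSimple)
    (h23 : ∀ m : Fin r, nI (is m) = 5 → (Finset.univ.filter fun s : Kf (is m) →+* ℂ => s.comp (iK (is m)) = τ ∧ s ∈ (Φ m.succ).1).card = 2 ∨
      (Finset.univ.filter fun s : Kf (is m) →+* ℂ => s.comp (iK (is m)) = τ ∧ s ∈ (Φ m.succ).1).card = 3)
    (hni : ∀ m, tw m ≠ m → ¬ AbelianVariety.IsIsogenous (A m.succ) (A (tw m).succ))
    (h24 : ∀ m : Fin r, nI (is m) = 4 → ∃ s₀ t₀ : Kf (is m) →+* ℂ, s₀.comp (iK (is m)) = τ ∧ t₀.comp (iK (is m)) = τ ∧ s₀ ≠ t₀ ∧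
      Module.finrank ℚ ↥(adjoin ℚ (Set.range τ) ⊔ adjoin ℚ (Set.range s₀ ∪ Set.range t₀)) = 24)
    (hiso : ∀ m₀ m : Fin r, m₀ ≠ m → tw m₀ ≠ m → nI (is m₀) = nI (is m) → (nI (is m) = 3 ∨ nI (is m) = 5) → IsEmpty (Kf (is m) →+* Kf (is m₀)))
    (hout4 : ∀ m₀ m : Fin r, m₀ ≠ m → nI (is m₀) = 4 → (nI (is m) = 4 ∨ nI (is m) = 3) →
      ∃ s : Kf (is m) →+* ℂ, s.comp (iK (is m)) = τ ∧ ∃ x, s x ∉ normalClosure ℚ (Kf (is m₀)) ℂ) :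
    HodgeConjectureFor (⨁ fun j => A (κ j)).dim (⨁ fun j => A (κ j)).X := by
  have hττ : ComplexEmbedding.conjugate τ ≠ τ := QuarticCM.conjugate_ne τ
  have hk : ∀ σ : Kf i₀ →+* ℂ, σ = τ ∨ σ = ComplexEmbedding.conjugate τ := fun σ => QuarticCM.eq_or_eq_conjugate_of_quadratic h2 τ σ
  obtain ⟨δ₀, d, hd, hδ₀⟩ := CyclicSextic.exists_sq_eq_neg_nat_of_isTotallyComplex (Kf i₀) h2
  obtain ⟨δ, hδ, hτ⟩ := OcticCurveFourfold.exists_delta_of_mem h2 hd hδ₀ τ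
  let im : ∀ m : Fin r, Kf i₀ →+* Kf (is m) := fun m => iK (is m)
  have hn : ∀ m, nI (is (tw m)) = nI (is m) := fun m => congrArg nI (hι m)
  -- (0) transports across an equality of indices, by substitution
  have homT : ∀ i j : I, i = j → Nonempty (Kf i →+* Kf j) := fun i j h => by subst h; exact ⟨RingHom.id _⟩
  have memT : ∀ i j : I, i = j → ∀ (s : Kf i →+* ℂ) (x : Kf i), s x ∈ normalClosure ℚ (Kf j) ℂ := fun i j h => by
    subst h; exact fun s x => ringHom_apply_mem_normalClosure s x
  have castT : ∀ i j : I, i = j → ∀ (Ψ : CMType (Kf i)) (B : AbelianVariety ℂ) (ιB : 𝓞 (Kf i) →+* End B)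
      (θB : Kf i →+* Module.End ℂ (complexBetti B.X 1)), IsCMTypeRealisation Ψ B ιB θB →
      ∃ (Ψ₂ : CMType (Kf j)) (ι₂ : 𝓞 (Kf j) →+* End B) (θ₂ : Kf j →+* Module.End ℂ (complexBetti B.X 1)), HEq Ψ₂ Ψ ∧ IsCMTypeRealisation Ψ₂ B ι₂ θ₂ := by
    intro i j h; subst h; exact fun Ψ B ιB θB hB => ⟨Ψ, ιB, θB, HEq.rfl, hB⟩
  have countT : ∀ i j : I, i = j → ∀ (Ψ : CMType (Kf i)) (Ψ₂ : CMType (Kf j)), HEq Ψ₂ Ψ →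
      (Finset.univ.filter fun s : Kf i →+* ℂ => s.comp (iK i) = τ ∧ s ∈ Ψ.1).card = 1 →
      (Finset.univ.filter fun s : Kf j →+* ℂ => s.comp (iK j) = τ ∧ s ∈ Ψ₂.1).card = 1 := by
    intro i j h; subst h; intro Ψ Ψ₂ hh; cases hh; exact id
  have heqT : ∀ i j : I, i = j → ∀ Ψ : CMType (Kf i), ∃ Ψ₂ : CMType (Kf j), HEq Ψ₂ Ψ := by
    intro i j h; subst h; exact fun Ψ => ⟨Ψ, HEq.rfl⟩
  -- (1) the normalised counts and structures: threefolds `1`, fourfolds `1` or `2`, fivefolds `2`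
  have hex : ∀ m : Fin r, ∃ pm : ℕ, pm ≤ nI (is m) ∧ ((nI (is m) = 3 ∧ pm = 1) ∨ (nI (is m) = 4 ∧ pm = 1) ∨ (nI (is m) = 4 ∧ pm = 2) ∨ (nI (is m) = 5 ∧ pm = 2)) ∧
      ((Finset.univ.filter fun s : Kf (is m) →+* ℂ => s.comp (im m) = τ ∧ s ∈ (Φ m.succ).1).card = pm ∨
        (Finset.univ.filter fun s : Kf (is m) →+* ℂ => s.comp (im m) = τ ∧ s ∈ (Φ m.succ).1).card = nI (is m) - pm) := fun m => by
    rcases hnI m with h | h | h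
    · refine ⟨1, by rw [h]; norm_num, Or.inl ⟨h, rfl⟩, ?_⟩
      rcases card_filter_mem_eq_one_or_two_of_isSimple (by rw [hdeg m, h]) h2 (im m) (hA m.succ) (hS m (Or.inl h)) τ with hc | hc
      · exact Or.inl hc
      · exact Or.inr (hc.trans (by rw [h] : nI (is m) - 1 = 2).symm)
    · rcases card_filter_mem_octic_of_isSimple (by rw [hdeg m, h]) h2 (im m) (hA m.succ) (hS m (Or.inr h)) τ with hc | hc | hc
      · exact ⟨1, by rw [h]; norm_num, Or.inr (Or.inl ⟨h, rfl⟩), Or.inl hc⟩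
      · exact ⟨2, by rw [h]; norm_num, Or.inr (Or.inr (Or.inl ⟨h, rfl⟩)), Or.inl hc⟩
      · exact ⟨1, by rw [h]; norm_num, Or.inr (Or.inl ⟨h, rfl⟩), Or.inr (hc.trans (by rw [h] : nI (is m) - 1 = 3).symm)⟩
    · refine ⟨2, by rw [h]; norm_num, Or.inr (Or.inr (Or.inr ⟨h, rfl⟩)), ?_⟩
      rcases h23 m h with hc | hc
      · exact Or.inl hc
      · exact Or.inr (hc.trans (by rw [h] : nI (is m) - 2 = 3).symm)
  choose p hpn hnp hor using hex
  obtain ⟨Φ', ι', θ', hA', h0, hp⟩ := exists_realisations_card_eq_of_or (n := fun m => nI (is m)) (Φ := Φ) h2 hdeg im hA p hpn hor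
  have hΨ' : ∀ σ : Kf i₀ →+* ℂ, σ ∈ (Φ' 0).1 ↔ σ = τ := by rw [h0]; exact hΨ
  have hp1 : ∀ m, tw m ≠ m → p m = 1 := fun m htm => by
    rcases hnp m with ⟨-, h⟩ | ⟨h, -⟩ | ⟨h, -⟩ | ⟨h, -⟩
    · exact h
    all_goals rw [htw3 m htm] at h; norm_num at h
  have h1 : ∀ m, tw m ≠ m → (Finset.univ.filter fun s : Kf (is m) →+* ℂ => s.comp (im m) = τ ∧ s ∈ (Φ' m.succ).1).card = 1 := fun m htm => by
    rw [hp m, hp1 m htm]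
  have slotT : ∀ a b : Fin r, a = b → HEq (Φ' a.succ) (Φ' b.succ) := fun a b h => by subst h; exact HEq.rfl
  -- (2) two slots with a common index lie in one unit
  have hexs : ∀ m : Fin r, ∃ s : Kf (is m) →+* ℂ, s.comp (im m) = τ := fun m => by
    have hc := SexticOcticWeil.card_filter_comp_eq_of_finrank (n := nI (is m)) (im m) (hdeg m) h2 τ
    obtain ⟨s, hs⟩ := Finset.card_pos.1 (by rw [hc]; rcases hnI m with h | h | h <;> rw [h] <;> norm_num)
    exact ⟨s, (Finset.mem_filter.1 hs).2⟩
  have hunit : ∀ m₀ m : Fin r, is m = is m₀ → m = m₀ ∨ m = tw m₀ := by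
    intro m₀ m h
    by_contra hne
    push Not at hne
    rcases hnI m with h3 | h4 | h5
    · exact (hiso m₀ m (Ne.symm hne.1) (Ne.symm hne.2) (by rw [h]) (Or.inl h3)).false (Classical.choice (homT _ _ h))
    · obtain ⟨s, -, x, hx⟩ := hout4 m₀ m (Ne.symm hne.1) (by rw [← h, h4]) (Or.inl h4)
      exact hx (memT _ _ h s x)
    · exact (hiso m₀ m (Ne.symm hne.1) (Ne.symm hne.2) (by rw [h]) (Or.inr h5)).false (Classical.choice (homT _ _ h))
  have hprim_or : ∀ m, tw m ≠ m → (m : ℕ) < (tw m : ℕ) ∨ (tw m : ℕ) < (m : ℕ) := fun m h => by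
    rcases lt_trichotomy (m : ℕ) (tw m : ℕ) with h' | h' | h'
    · exact Or.inl h'
    · exact absurd (Fin.ext h').symm h
    · exact Or.inr h'
  have hn0 : ∀ m, 0 < nI (is m) := fun m => by rcases hnI m with h | h | h <;> rw [h] <;> norm_num
  have hn1 : ∀ m, 1 < nI (is m) := fun m => by rcases hnI m with h | h | h <;> rw [h] <;> norm_num
  -- (3) ONE frame PER INDEX: dihedral at the doubled (sextic) indices, a sign frame elsewhere
  have hfr : ∀ (i : I) (ni : ℕ), Module.finrank ℚ (Kf i) = 2 * ni → ∃ E : (Kf i →+* ℂ) ≃ Fin ni × Bool,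
      (∀ s, (E s).2 = true ↔ s.comp (iK i) = τ) ∧ (∀ s, E (ComplexEmbedding.conjugate s) = ((E s).1, !(E s).2)) ∧
      ∀ p : Fin r, is p = i → tw p ≠ p → (p : ℕ) < (tw p : ℕ) → ∃ h3 : ni = 3,
        (∀ a a' b b' : Fin ni, a ≠ a' → b ≠ b' → ∃ σ : ℂ ≃+* ℂ, (σ : ℂ →+* ℂ).comp τ = τ ∧
          (σ : ℂ →+* ℂ).comp (E.symm (a, true)) = E.symm (b, true) ∧ (σ : ℂ →+* ℂ).comp (E.symm (a', true)) = E.symm (b', true)) ∧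
        (∀ Ψ₁ : CMType (Kf i), HEq Ψ₁ (Φ' p.succ) → ∀ s, s ∈ Ψ₁.1 ↔ (E s).2 = decide ((E s).1 = ⟨0, by rw [h3]; norm_num⟩)) ∧
        (∀ Ψ₂ : CMType (Kf i), HEq Ψ₂ (Φ' (tw p).succ) → ∀ s, s ∈ Ψ₂.1 ↔ (E s).2 = decide ((E s).1 = ⟨1, by rw [h3]; norm_num⟩)) := by
    intro i ni hdi
    by_cases hx : ∃ p : Fin r, is p = i ∧ tw p ≠ p ∧ (p : ℕ) < (tw p : ℕ)
    · obtain ⟨p, rfl, htp, hlt⟩ := hx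
      have h6 : Module.finrank ℚ (Kf (is p)) = 6 := by rw [hdeg p, htw3 p htp]
      have h3 : ni = 3 := by have := hdeg p; rw [htw3 p htp, hdi] at this; omega
      subst h3
      -- the partner's structure, read over the common index
      obtain ⟨Ψ₂, ι₂, θ₂, hh₂, hA₂⟩ := castT _ _ (hι p) (Φ' (tw p).succ) (A (tw p).succ) (ι' (tw p).succ) (θ' (tw p).succ) (hA' (tw p).succ)
      have htp' : tw (tw p) ≠ tw p := by rw [htw]; exact htp.symm
      have hone₂ := countT _ _ (hι p) (Φ' (tw p).succ) Ψ₂ hh₂ (h1 (tw p) htp')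
      have hK : ¬ IsGalois ℚ (Kf (is p)) :=
        SexticCMThreefoldPair.not_isGalois_of_isSimple_of_not_isIsogenous h6 h2 (iK (is p)) (hA' p.succ) hA₂ (hS p (Or.inl (htw3 p htp)))
          (hS (tw p) (Or.inl (by rw [hn]; exact htw3 p htp))) (hni p htp)
      have hne : (Φ' p.succ).1 ≠ Ψ₂.1 := (DihedralSexticPair.cmType_ne_and_ne_compl_of_not_isIsogenous (hA' p.succ) hA₂ (hni p htp)).1
      have hdich : ∀ s : Kf (is p) →+* ℂ, s.comp (iK (is p)) = τ ∨ s.comp (iK (is p)) = ComplexEmbedding.conjugate τ := fun s => hk _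
      let Φ₂ : Fin 2 → CMType (Kf (is p)) := Fin.cons (Φ' p.succ) fun _ => Ψ₂
      have hone : ∀ j : Fin 2, (Finset.univ.filter fun s : Kf (is p) →+* ℂ => s.comp (iK (is p)) = τ ∧ s ∈ (Φ₂ j).1).card = 1 :=
        Fin.forall_fin_two.2 ⟨h1 p htp, hone₂⟩
      have hne₂ : (Φ₂ 0).1 ≠ (Φ₂ 1).1 := hne
      obtain ⟨E, he_conj, he_sign', he_gal, hΦe⟩ := DihedralSexticPair.exists_frame_of_card_fibre_eq_one hττ hdich hK h6 (Φ := Φ₂) hone hne₂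
      have he_sign : ∀ s : Kf (is p) →+* ℂ, (E s).2 = true ↔ s.comp (iK (is p)) = τ := fun s => (he_sign' s).symm
      have hgal : ∀ a a' b b' : Fin 3, a ≠ a' → b ≠ b' → ∃ σ : ℂ ≃+* ℂ, (σ : ℂ →+* ℂ).comp τ = τ ∧
          (σ : ℂ →+* ℂ).comp (E.symm (a, true)) = E.symm (b, true) ∧ (σ : ℂ →+* ℂ).comp (E.symm (a', true)) = E.symm (b', true) := by
        intro a a' b b' haa hbb
        obtain ⟨j, f, hb, hb'⟩ := exists_affine_zmod3 a a' b b' haa hbb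
        obtain ⟨σ, hσ⟩ := he_gal j f
        have hmove : ∀ x : ZMod 3, (σ : ℂ →+* ℂ).comp (E.symm (x, true)) = E.symm ((if f then -x else x) + j, true) := fun x => by
          have h := hσ (E.symm (x, true))
          rw [Equiv.apply_symm_apply] at h
          rw [← h, Equiv.symm_apply_apply]
        refine ⟨σ, ?_, by rw [hmove a, hb], by rw [hmove a', hb']⟩
        have hs : (E.symm (0, true)).comp (iK (is p)) = τ := (he_sign _).1 (by rw [Equiv.apply_symm_apply])
        have hs' : (E.symm ((if f then -0 else 0) + j, true)).comp (iK (is p)) = τ := (he_sign _).1 (by rw [Equiv.apply_symm_apply])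
        calc (σ : ℂ →+* ℂ).comp τ = ((σ : ℂ →+* ℂ).comp (E.symm (0, true))).comp (iK (is p)) := by rw [RingHom.comp_assoc, hs]
          _ = τ := by rw [hmove 0, hs']
      have hv0 : ∀ x : ZMod 3, x.val = (0 : Fin 2).val ↔ x = (0 : Fin 3) := by decide
      have hv1 : ∀ x : ZMod 3, x.val = (1 : Fin 2).val ↔ x = (1 : Fin 3) := by decide
      have hrd0 : ∀ s : Kf (is p) →+* ℂ, s ∈ (Φ' p.succ).1 ↔ (E s).2 = decide ((E s).1 = (0 : Fin 3)) := fun s => by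
        refine (hΦe 0 s).trans ?_
        rw [decide_eq_decide.2 (hv0 _)]
      have hrd1 : ∀ s : Kf (is p) →+* ℂ, s ∈ Ψ₂.1 ↔ (E s).2 = decide ((E s).1 = (1 : Fin 3)) := fun s => by
        refine (hΦe 1 s).trans ?_
        rw [decide_eq_decide.2 (hv1 _)]
      refine ⟨E, he_sign, he_conj, fun p' hp' htp' hlt' => ?_⟩
      obtain rfl : p' = p := by
        rcases hunit p p' hp' with h | h
        · exact h
        · exfalso
          rw [h, htw] at hlt'
          omega
      refine ⟨rfl, hgal, fun Ψ₁ hh s => ?_, fun Ψ hh s => ?_⟩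
      · have hΨ₁ : Ψ₁ = Φ' p'.succ := eq_of_heq hh
        subst hΨ₁
        exact hrd0 s
      · have hΨ : Ψ = Ψ₂ := eq_of_heq (hh.trans hh₂.symm)
        subst hΨ
        exact hrd1 s
    · obtain ⟨E, he_sign, he_conj⟩ := exists_signFrame hdi h2 (iK i) hττ hk
      exact ⟨E, he_sign, he_conj, fun p hp htp hlt => absurd ⟨p, hp, htp, hlt⟩ hx⟩
  choose E hE_sign hE_conj hE_twin using hfr
  -- transports with the frames in place
  have galT : ∀ i j : I, ∀ h : i = j, ∀ (hi : Module.finrank ℚ (Kf i) = 2 * nI i) (hj : Module.finrank ℚ (Kf j) = 2 * nI j),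
      (∀ a a' b b' : Fin (nI i), a ≠ a' → b ≠ b' → ∃ σ : ℂ ≃+* ℂ, (σ : ℂ →+* ℂ).comp τ = τ ∧
        (σ : ℂ →+* ℂ).comp ((E i (nI i) hi).symm (a, true)) = (E i (nI i) hi).symm (b, true) ∧
        (σ : ℂ →+* ℂ).comp ((E i (nI i) hi).symm (a', true)) = (E i (nI i) hi).symm (b', true)) →
      ∀ a a' b b' : Fin (nI j), a ≠ a' → b ≠ b' → ∃ σ : ℂ ≃+* ℂ, (σ : ℂ →+* ℂ).comp τ = τ ∧
        (σ : ℂ →+* ℂ).comp ((E j (nI j) hj).symm (a, true)) = (E j (nI j) hj).symm (b, true) ∧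
        (σ : ℂ →+* ℂ).comp ((E j (nI j) hj).symm (a', true)) = (E j (nI j) hj).symm (b', true) := by
    intro i j h; subst h; exact fun _ _ hg => hg
  have readT : ∀ i j : I, ∀ h : i = j, ∀ (hi : Module.finrank ℚ (Kf i) = 2 * nI i) (hj : Module.finrank ℚ (Kf j) = 2 * nI j) (Ψ : CMType (Kf i)) (Ψ₂ : CMType (Kf j))
      (qi : Fin (nI i)) (qj : Fin (nI j)), (qi : ℕ) = (qj : ℕ) →
      HEq Ψ₂ Ψ → (∀ s, s ∈ Ψ₂.1 ↔ (E j (nI j) hj s).2 = decide ((E j (nI j) hj s).1 = qj)) → ∀ s, s ∈ Ψ.1 ↔ (E i (nI i) hi s).2 = decide ((E i (nI i) hi s).1 = qi) := by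
    intro i j h; subst h
    intro hi hj Ψ Ψ₂ qi qj hq hh hr
    have hΨ : Ψ₂ = Ψ := eq_of_heq hh
    subst hΨ
    have hqq : qj = qi := Fin.ext hq.symm
    subst hqq
    exact hr
  have diagT : ∀ i j : I, ∀ h : i = j, ∀ (hi : Module.finrank ℚ (Kf i) = 2 * nI i) (hj : Module.finrank ℚ (Kf j) = 2 * nI j) (ρ : ℂ →+* ℂ)
      (a : Fin (nI i)) (x : Fin (nI i)) (y : Fin (nI j)),
      ρ.comp ((E i (nI i) hi).symm (a, true)) = (E i (nI i) hi).symm (x, true) →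
      ρ.comp ((E j (nI j) hj).symm (Fin.cast (congrArg nI h) a, true)) = (E j (nI j) hj).symm (y, true) → Fin.cast (congrArg nI h) x = y := by
    intro i j h; subst h
    intro hi hj ρ a x y h₁ h₂
    have ha : Fin.cast (congrArg nI (rfl : i = i)) a = a := Fin.ext rfl
    rw [ha] at h₂
    exact (Fin.ext rfl : Fin.cast _ x = x).trans (Prod.mk.inj ((E i (nI i) hi).symm.injective (h₁.symm.trans h₂))).1
  -- (4) the frames of the slots and their readings
  let e : ∀ m : Fin r, (Kf (is m) →+* ℂ) ≃ Fin (nI (is m)) × Bool := fun m => E (is m) (nI (is m)) (hdeg m)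
  have he_sign : ∀ (m : Fin r) (s : Kf (is m) →+* ℂ), (e m s).2 = true ↔ s.comp (im m) = τ := fun m => hE_sign (is m) (nI (is m)) (hdeg m)
  have he_conj : ∀ (m : Fin r) (s : Kf (is m) →+* ℂ), e m (ComplexEmbedding.conjugate s) = ((e m s).1, !(e m s).2) := fun m => hE_conj (is m) (nI (is m)) (hdeg m)
  have hgal : ∀ m, tw m ≠ m → ∀ a a' b b' : Fin (nI (is m)), a ≠ a' → b ≠ b' → ∃ σ : ℂ ≃+* ℂ, (σ : ℂ →+* ℂ).comp τ = τ ∧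
      (σ : ℂ →+* ℂ).comp ((e m).symm (a, true)) = (e m).symm (b, true) ∧ (σ : ℂ →+* ℂ).comp ((e m).symm (a', true)) = (e m).symm (b', true) := by
    intro m htm
    rcases hprim_or m htm with hlt | hlt
    · obtain ⟨-, hg, -, -⟩ := hE_twin (is m) (nI (is m)) (hdeg m) m rfl htm hlt
      exact hg
    · have htm' : tw (tw m) ≠ tw m := by rw [htw]; exact htm.symm
      have hlt' : ((tw m : Fin r) : ℕ) < (tw (tw m) : ℕ) := by rw [htw]; exact hlt
      obtain ⟨-, hg, -, -⟩ := hE_twin (is (tw m)) (nI (is (tw m))) (hdeg (tw m)) (tw m) rfl htm' hlt'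
      exact galT _ _ (hι m) (hdeg (tw m)) (hdeg m) hg
  let q : ∀ m : Fin r, Fin (nI (is m)) := fun m => if (m : ℕ) < (tw m : ℕ) then ⟨0, hn0 m⟩ else ⟨1, hn1 m⟩
  have hread : ∀ m, tw m ≠ m → ∀ s : Kf (is m) →+* ℂ, s ∈ (Φ' m.succ).1 ↔ (e m s).2 = decide ((e m s).1 = q m) := by
    intro m htm
    rcases hprim_or m htm with hlt | hlt
    · have hq : q m = ⟨0, hn0 m⟩ := by simp only [q, if_pos hlt]
      rw [hq]
      obtain ⟨h3, -, hr, -⟩ := hE_twin (is m) (nI (is m)) (hdeg m) m rfl htm hlt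
      exact hr (Φ' m.succ) HEq.rfl
    · have hq : q m = ⟨1, hn1 m⟩ := by simp only [q, if_neg (lt_asymm hlt)]
      rw [hq]
      have htm' : tw (tw m) ≠ tw m := by rw [htw]; exact htm.symm
      have hlt' : ((tw m : Fin r) : ℕ) < (tw (tw m) : ℕ) := by rw [htw]; exact hlt
      obtain ⟨Ψ₂, hh⟩ := heqT _ _ (hι m).symm (Φ' m.succ)
      have hh' : HEq Ψ₂ (Φ' (tw (tw m)).succ) := hh.trans (slotT _ _ (htw m).symm)
      obtain ⟨h3, -, -, hr⟩ := hE_twin (is (tw m)) (nI (is (tw m))) (hdeg (tw m)) (tw m) rfl htm' hlt'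
      exact readT _ _ (hι m).symm (hdeg m) (hdeg (tw m)) (Φ' m.succ) Ψ₂ ⟨1, hn1 m⟩ ⟨1, hn1 (tw m)⟩ rfl hh (hr Ψ₂ hh')
  -- position sets
  let P : ∀ m : Fin r, Finset (Fin (nI (is m))) := fun m => Finset.univ.filter fun a : Fin (nI (is m)) => (e m).symm (a, true) ∈ (Φ' m.succ).1
  have hΦ : ∀ (m : Fin r) (s : Kf (is m) →+* ℂ), s ∈ (Φ' m.succ).1 ↔ (e m s).2 = decide ((e m s).1 ∈ P m) := fun m s =>
    mem_iff_snd_eq_decide_mem_posSet (he_conj m) (Φ' m.succ) s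
  have hcard : ∀ m : Fin r, (P m).card = p m := fun m => (card_posSet (he_sign m) (Φ' m.succ)).trans (hp m)
  have hPq : ∀ m, tw m ≠ m → P m = {q m} := by
    intro m htm
    ext a
    rw [Finset.mem_singleton, Finset.mem_filter, hread m htm, Equiv.apply_symm_apply]
    simp only [Finset.mem_univ, true_and, true_eq_decide_iff]
  have hq : ∀ m, tw m ≠ m → Fin.cast (hn m) (q (tw m)) ≠ q m := by
    intro m htm hqq
    have hv := congrArg Fin.val hqq
    rw [Fin.val_cast] at hv
    simp only [q, htw] at hv
    rcases hprim_or m htm with hlt | hlt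
    · rw [if_neg (lt_asymm hlt), if_pos hlt] at hv; exact absurd hv (by norm_num)
    · rw [if_pos hlt, if_neg (lt_asymm hlt)] at hv; exact absurd hv (by norm_num)
  -- (5) the realised tuples are DIAGONAL on every pair and `2`-transitive there
  have hdg : ∀ π ∈ realisedTuples e τ, ∀ m, tw m ≠ m → ∀ a : Fin (nI (is (tw m))), Fin.cast (hn m) (π (tw m) a) = π m (Fin.cast (hn m) a) := by
    intro π hπ m _ a
    obtain ⟨ρ, -, hρ⟩ := (mem_realisedTuples e τ π).1 hπ
    exact diagT _ _ (hι m) (hdeg (tw m)) (hdeg m) (ρ : ℂ →+* ℂ) a (π (tw m) a) (π m (Fin.cast (hn m) a)) (hρ (tw m) a) (hρ m (Fin.cast (hn m) a))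
  have h2t : ∀ m, tw m ≠ m → ∀ a a' b b' : Fin (nI (is m)), a ≠ a' → b ≠ b' → ∃ π ∈ realisedTuples e τ, π m a = b ∧ π m a' = b' := by
    intro m htm a a' b b' haa hbb
    obtain ⟨σ, hστ, hσa, hσa'⟩ := hgal m htm a a' b b' haa hbb
    obtain ⟨π, hπ, hπσ⟩ := exists_mem_realisedTuples_of_comp_tau_eq (e := e) he_sign σ hστ
    have ha : (σ : ℂ →+* ℂ).comp ((e m).symm (a, true)) = (e m).symm (π m a, true) := hπσ m a
    have ha' : (σ : ℂ →+* ℂ).comp ((e m).symm (a', true)) = (e m).symm (π m a', true) := hπσ m a'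
    exact ⟨π, hπ, (Prod.mk.inj ((e m).symm.injective (ha.symm.trans hσa))).1, (Prod.mk.inj ((e m).symm.injective (ha'.symm.trans hσa'))).1⟩
  -- the octic slots: `2`-transitive realised tuples (degree `24`)
  have h2t4 : ∀ m, nI (is m) = 4 → ∀ a b a' b' : Fin (nI (is m)), a ≠ b → a' ≠ b' → ∃ π ∈ realisedTuples e τ, π m a = a' ∧ π m b = b' := fun m h4 =>
    twoTransitive_realisedTuples_of_aut (e := e) he_sign m (h2T_of_finrank_pair_octic h2 im hdeg h24 m h4)
  -- (6) stabiliser-transitivity across units: the nine cases of Z3 (a value outside the closure within a degree ∕ for octic sources; free otherwise)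
  have hout : ∀ m₀ m : Fin r, m₀ ≠ m → tw m₀ ≠ m → (nI (is m₀) = nI (is m) ∨ (nI (is m₀) = 4 ∧ nI (is m) = 3)) →
      ∃ s : Kf (is m) →+* ℂ, s.comp (im m) = τ ∧ ∃ x, s x ∉ normalClosure ℚ (Kf (is m₀)) ℂ := by
    intro m₀ m h₁ h₂ hnm
    obtain ⟨s, hs⟩ := hexs m
    rcases hnm with heq | ⟨h4₀, h3⟩
    · rcases hnI m with h3 | h4 | h5
      · exact ⟨s, hs, exists_apply_not_mem_normalClosure_of_isEmpty_ringHom h2 im (by rw [hdeg m₀, heq, h3]) (by rw [hdeg m, h3])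
          (hiso m₀ m h₁ h₂ heq (Or.inl h3)) s hs⟩
      · exact hout4 m₀ m h₁ (heq.trans h4) (Or.inl h4)
      · exact ⟨s, hs, exists_apply_not_mem_normalClosure_of_isEmpty_ringHom_five h2 im (by rw [hdeg m₀, heq, h5]) (by rw [hdeg m, h5])
          (hiso m₀ m h₁ h₂ heq (Or.inr h5)) s hs⟩
    · exact hout4 m₀ m h₁ h4₀ (Or.inr h3)
  have hstab₀ : ∀ (m₀ m : Fin r), m₀ ≠ m → tw m₀ ≠ m → ∀ a a' : Fin (nI (is m)), ∃ ν ∈ realisedTuples e τ, ν m₀ = 1 ∧ ν m a = a' := by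
    intro m₀ m h₁ h₂ a a'
    rcases hnI m with h3 | h4 | h5
    · rcases hnI m₀ with h3₀ | h4₀ | h5₀
      · exact stabTransitive_realisedTuples_of_outside_prime (e := e) he_sign m₀ m (by rw [h3]; exact Nat.prime_three) (hout m₀ m h₁ h₂ (Or.inl (h3₀.trans h3.symm))) a a'
      · exact stabTransitive_realisedTuples_of_outside_prime (e := e) he_sign m₀ m (by rw [h3]; exact Nat.prime_three) (hout m₀ m h₁ h₂ (Or.inr ⟨h4₀, h3⟩)) a a'
      · exact stabTransitive_realisedTuples_of_sizes_three_five (e := e) he_sign m₀ m (Or.inl ⟨h5₀, h3⟩) a a'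
    · rcases hnI m₀ with h3₀ | h4₀ | h5₀
      · exact stabTransitive_realisedTuples_into_four (e := e) he_sign m₀ m (Or.inl h3₀) h4 (h2t4 m h4) a a'
      · exact stabTransitive_realisedTuples_of_outside_twoTransitive (e := e) he_sign m₀ m (h2t4 m h4) (hout m₀ m h₁ h₂ (Or.inl (h4₀.trans h4.symm))) a a'
      · exact stabTransitive_realisedTuples_into_four (e := e) he_sign m₀ m (Or.inr h5₀) h4 (h2t4 m h4) a a'
    · rcases hnI m₀ with h3₀ | h4₀ | h5₀
      · exact stabTransitive_realisedTuples_of_sizes_three_five (e := e) he_sign m₀ m (Or.inr ⟨h3₀, h5⟩) a a'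
      · exact stabTransitive_realisedTuples_into_five_of_four (e := e) he_sign m₀ m h4₀ h5 a a'
      · exact stabTransitive_realisedTuples_of_outside_prime (e := e) he_sign m₀ m (by rw [h5]; exact Nat.prime_five) (hout m₀ m h₁ h₂ (Or.inl (h5₀.trans h5.symm))) a a'
  have hstab : ∀ (m₀ m : Fin r), m₀ ≠ m → tw m₀ ≠ m → ∀ a a' : Fin (nI (is m)), ∃ ν ∈ realisedTuples e τ, ν m₀ = 1 ∧ ν (tw m₀) = 1 ∧ ν m a = a' := by
    intro m₀ m h₁ h₂ a a'
    obtain ⟨ν, hν, hν0, hνa⟩ := hstab₀ m₀ m h₁ h₂ a a'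
    refine ⟨ν, hν, hν0, ?_, hνa⟩
    by_cases ht : tw m₀ = m₀
    · rw [ht]; exact hν0
    · ext b
      have hb := hdg ν hν m₀ ht b
      rw [hν0, Equiv.Perm.one_apply] at hb
      have hb' := congrArg Fin.val hb
      rw [Fin.val_cast, Fin.val_cast] at hb'
      exact hb'
  -- (7) the slot menu on the single slots
  have hkind : ∀ m : Fin r, tw m = m → (nI (is m)).Prime ∨ p m = 1 ∨ ∀ Q : Finset (Fin (nI (is m))), Q.card = p m → ∃ π ∈ realisedTuples e τ, preG (π m) (P m) = Q := by
    intro m _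
    rcases hnp m with ⟨h, -⟩ | ⟨-, h'⟩ | ⟨h, h'⟩ | ⟨h, -⟩
    · exact Or.inl (by rw [h]; exact Nat.prime_three)
    · exact Or.inr (Or.inl h')
    · have hhom := homogeneous_two_of_twoTransitive (R := realisedTuples e τ) (P := P) (m := m) (by rw [hcard m, h']) (h2t4 m h)
      exact Or.inr (Or.inr fun Q hQ => hhom Q (by rw [hQ, hcard m]))
    · exact Or.inl (by rw [h]; exact Nat.prime_five)
  -- (8) the engine with several twin pairs and the slot menu; the single-slot Weil spaces from Markman's theorems
  exact hodgeConjectureFor_biproduct_comp_of_twins_kind_frames (is := is) (n := fun m => nI (is m)) P p hcard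
    (fun m => by rcases hnp m with ⟨-, h⟩ | ⟨-, h⟩ | ⟨-, h⟩ | ⟨-, h⟩ <;> rw [h] <;> norm_num)
    (fun m => by rcases hnp m with ⟨h, h'⟩ | ⟨h, h'⟩ | ⟨h, h'⟩ | ⟨h, h'⟩ <;> rw [h, h'] <;> norm_num)
    κ h2 im hτ hA' e he_sign he_conj hΨ' hΦ tw htw hn (fun m htm => by rw [htw3 m htm]) (fun π hπ m htm a => hdg π hπ m htm a) h2t hstab q hPq hq hkind
    fun m => weilHyp_of_markman_intrinsic hW4 hM6 m (hnp m) (hdeg m) h2 hd hδ hA' hΨ' (hp m)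

end TwinsMenu

end Summit.HodgeConjecture.CorCM.MultiFieldWeil

end
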